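import Literature.MathematicalPhysics.QuantumFieldTheory.Balaban1983to89.T4SizeLedger
import Literature.MathematicalPhysics.QuantumFieldTheory.Balaban1983to89.T4Enlargement
import Literature.MathematicalPhysics.QuantumFieldTheory.Balaban1983to89.T4GenealogyLifetime

/-!
# `Balaban1983to89.T4GeometricLedger` — THE TWO SIZE INPUTS OF LEMMA Y ON A GEOMETRIC REALISATION OF THE GENEALOGY
LEDGER (cell `pub-balaban`, node U5; record `t4/T4-EST-U5E-rem.md` §4 (unit `b2b-balaban-pv25`); journal CLAIM
T4-U5.E-REM-GEOLEDGER-K* 2026-08-19T06:04:35Z, unit `b2b-balaban-pv25` gen 8 — NEW leaf module over this lineage's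
`…T4SizeLedger` (p182963) and `…T4Enlargement` (p183277) and over `…T4GenealogyLifetime` (p183725, proposed by unit
`b2b-balaban-pv18`; it carries `…T4Genealogy` (p183565), `…T4EpochSize` (p183023), `…T4BankAgeYoung` (p182815));
modifies nothing)

HONEST FRAMING (cell `pub-balaban`, T4-DAG PAGE 1).  The cell's T4 target is the existence AND uniqueness of the
continuum limit of Bałaban's unit-scale averaged loop expectations on a finite torus — strictly beyond ultraviolet
stability ([Balaban1989LargeFieldII] Thm 1 p. 355); it is NOT the Yang–Mills mass gap and NOT the Clay problem.  This
module is LATTICE-GEOMETRIC BOOKKEEPING ON THE CELL'S SIZE MODEL ONLY [folklore].  NOTHING of [Balaban1989LargeFieldII],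
[Balaban1988RG2Cluster] or [Balaban1987RG1] is asserted here: there is no quotation, no page claim and no `[cite:]` tag in
this file.  The printed loci this model stands for (B16 pp. 384–387: the operation `S`, the re-covering chain (α)/(β), the
enlargement inequality (γ) of p. 385, the merge step (1.84)–(1.87) of p. 386) are quoted — render-read — in the headers of
`…B16SProfile`, `…B16MergeGeometry`, `…T4SizeLedger`, `…T4Enlargement`; the print ↔ model identifications are recorded in
`t4/T4-EST-U5E-rem-ident.md` (unit b01).  Every reading this file makes is named below.

WHAT THIS MODULE ADDS (all kernel-checked).  `…T4Genealogy.Ledger.lifetime_binders_four` proves the eight data binders of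
`…T4BankAgeYoung.lifetime_lt` (Lemma Y: small bank ⇒ recent creation) for a well-formed genealogy ledger FROM TWO SIZE
INPUTS, left there as hypotheses in the shapes of `…T4SizeLedger`:
`hfnd : ∀ e ≤ E, ∀ ℓ ∈ founded e, size ℓ + 1 ≤ 4·14^d·fmass ℓ` (per foundation) and
`hev : ∀ e < E, size (product e) + 2 ≤ C·Σ_{ℓ ∈ consumed e}(size ℓ + 1) + 2·#(consumed e) + 4·14^d·gmass e` (per event);
`…T4GenealogyLifetime` composes Lemma Y on the ledger with them still as hypotheses and says why: «that composition needs a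
geometric realisation of the ledger, i.e. a region per lineage and epoch, which this file does not posit».  Here that
realisation is typed, both inputs are PROVED from it BY NAME from the lineage's model leaves, and Lemma Y is composed
END TO END for it (§5):
* §1 `GeoLedger d κ ι` — a genealogy ledger whose lineages carry LOCALIZATION DOMAINS in `ℤᵈ`: the ledger skeleton
  (`E`, `founded`, `consumed`, `product`, `base₀`) as in `…T4Genealogy.Ledger`; per lineage `ℓ` its epoch-start domain
  `dom ℓ : Finset (Pt d)`, the exponent profile `expo ℓ` and the number `steps ℓ` of `S`-steps of its epoch (so that its
  domain when consumed is `cur ℓ = Siter (ratio L (expo ℓ)) (steps ℓ) (dom ℓ)`, `…B16SProfile`); born regions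
  `region i : Finset (Pt d)` (names `i : ι`), entering the history as their triple enlargements
  `newPart i = collar^[3] (region i)`; the founding regions `fregions ℓ` of a lineage and the regions `eregions e` born
  into event `e+1`.  The NUMERICAL ledger `toLedger : …T4Genealogy.Ledger κ` is DEFINED from it: `size ℓ = treeLen (dom ℓ)`
  (`…TreeLength.treeLen`, the cell's model of print's `d′_j`), `fmass ℓ = Σ_{i ∈ fregions ℓ}(treeLen (region i) + 1)`,
  `gmass e = Σ_{i ∈ eregions e}(treeLen (region i) + 1)`.
* §1 `Geometric` — the geometric sentences of the model: `4 ≤ L`; every domain and every region non-empty and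
  face-connected (`…B13ScaleTransfer.FaceConnected`, [Balaban1987RG1] p. 257's localization domains as typed there); the
  drop control `DropCtl (expo ℓ) (steps ℓ)` of `…B16SProfile` along each epoch; (M-F) a FOUNDED lineage's domain IS the
  union of the triple enlargements of its founding regions, `dom ℓ = fam newPart (fregions ℓ)`; (M-E) the PRODUCT of event
  `e+1` has domain EQUAL TO the union of the consumed lineages' current domains and the new parts,
  `dom (product e) = fam parts (V e)` (`…B16MergeGeometry.fam`; `parts = Sum.elim cur newPart` on `κ ⊕ ι`,
  `V e = (consumed e).disjSum (eregions e) = O e ∪ N e`, `O e = (consumed e).map inl`, `N e = (eregions e).map inr`) —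
  the UNION READING of (1.84) of `…T4SizeLedger` (print has an inclusion `Z ⊂ ⋃_v X_v`; the cover reading with Steiner
  sizes is `…T4SizeLedger.event_steinerLen_cover_le` and is NOT composed here, because step (2a), `…T4EpochSize`, is a
  statement about `treeLen`).
* §2 `hfnd_of_geometric` — the FOUNDATION INPUT with `a = 4·14^d`: `…T4SizeLedger.foundation_size_le` (one unit to spare) fed
  with `…T4Enlargement.hnew_collar_three` ((γ) on the model) and `admissible_iterate_collar`, the touch-tree-connectedness of
  the founding family from the face-connectedness of `dom ℓ` (`…B16MergeGeometry.gconn_touchGraph_of_faceConnected`).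
* §2 `hev_of_geometric` — the EVENT INPUT with `C = …T4EpochSize.modelC d = 10·126^d` and `a = 4·14^d`:
  `…T4SizeLedger.event_size_le` fed with `…T4EpochSize.epochSize_le_modelC` ((2a): an old part within its drop-control
  horizon has `treeLen (cur ℓ) ≤ modelC d·(treeLen (dom ℓ) + 1)`), `…T4Enlargement.hnew_collar_three` (new parts), member
  admissibility (`…TreeLength.exists_admissible` on `cur ℓ` via `…B16SProfile.Siter_nonempty` / `faceConnected_Siter`),
  `O e`, `N e` disjoint by construction, tree-connectedness from the face-connectedness of `dom (product e)`; the sums over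
  `O e` / `N e` are transported back to `consumed e` / `eregions e` by `Finset.sum_map`.
* §3 `wf_of_geometric` — `toLedger.WF` from the two COMBINATORIAL sentences only (`base₀ ∈ founded 0`, consumed parts
  alive): sizes are `treeLen ≥ 0`, a founded lineage has a founding region (its domain is non-empty) so `fmass ≥ 1`,
  `gmass ≥ 0`; and `lifetime_binders_of_geometric` = `…T4Genealogy.Ledger.lifetime_binders_four` with BOTH SIZE INPUTS
  DISCHARGED: from `Geometric`, the two combinatorial sentences, `1 ≤ d`, `E ≤ m` and `Dtot ≤ D`, the eight data binders
  `hf hv hΨ0 hfound hstep hD hV hσ` of `lifetime_lt` hold for `toLedger` with `C = modelC d` and new-part constant `4·14^d`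
  (the shapes of `…T4BankAgeYoung` v1.1's `lifetime_lt_four`; for v1's `lifetime_lt` (constant `2·14^d`) the factor `2` is
  absorbed by the rescaling `f ↦ 2f`, `D ↦ 2D`, `c_s ↦ c_s/2` of that module's §9 — not repeated here).
* §5 `lifetime_lt_of_geometric` — LEMMA Y FOR A GEOMETRIC LEDGER, END TO END:
  `…T4GenealogyLifetime.lifetime_lt_of_ledger_cover` applied to the ledger with DOUBLED BOOKING `toLedger₂` (every region
  booked with mass `2·(treeLen + 1)`, which turns the model's `4·14^d` into the literal `2·14^d` of `lifetime_lt` — the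
  ledger-side form of `…T4BankAgeYoung` v1.1 §9's rescaling; price: the credit reading `Dtot₂ = 2·Dtot ≤ D`, i.e. (P5)
  doubled to (P5₂), record §6) with EVERY MODEL-SIDE BINDER DISCHARGED — `WF`, `hfnd`, `hev`, the epoch bases
  `Z i = dom (base i)` (`base 0 = base₀`, `base (e+1) = product e`) with their own exponent profiles and horizons, `hZσ`
  with equality (`treeLen_dom_base_le_σ`), hence `hint` / `hhalf` by `…T4EpochSize.coverProfile_int/_halving` — at `m = E`
  and with the epoch lengths BEING the `S`-step counts `steps (base i)`: from the S-side credit hypotheses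
  (`hDD hce hp hP5 hb hbA`), the printed horizon per epoch (`hlen`, `hR`, `hRmax`), `1 ≤ d` and the two combinatorial
  sentences, `Σ_{i ≤ E} steps (base i) < A·epochAllowance d (modelC d) R_max A`.
* §4 NON-VACUITY at `d = 1`: a creation lineage founded on one cube (domain = its triple collar, a row of seven cubes),
  merged at once (`steps = 0`) with the triple collar of the neighbouring born cube into the triple collar of the two-cube
  row; `Geometric`, `WF`, one event with one consumed part and one born part — jointly inhabited, and `hev` evaluated.

WHAT REMAINS A BINDER / A READING (named, not hidden).  (i) The S-SIDE CREDITS: `E ≤ m` (here `m = E`), `Dtot ≤ D`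
(§5: `Dtot₂ = 2·Dtot ≤ D`), the bank inequality `hb`, `hbA` and (P5) `hce hp hP5` of `lifetime_lt` (record §3 S1, §6
[analysis]).  (ii) The printed HORIZON per epoch, `hlen` («K ≤ n₀ − j + R_j», [Balaban1989LargeFieldII] p. 385 — a
LOCATION read in the record, not asserted; here: the base lineage's step count is at most an index that is `0` or carries a
cover of positive model size, plus the window `R i ≤ R_max`); the profile binders `hint` / `hhalf` are discharged in §5.
(iii) THE READING that a printed sub-history of a large-field component IS a `Geometric` `GeoLedger`: one epoch-start
domain per lineage evolved by `S` with drop-controlled exponents until the consuming event ((2a)'s regime, record §4), the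
epoch lengths being these step counts; founded domains = triple enlargements of the founding regions (L5); the merged
domain = the union of the covering family ((M-E), the union reading of (1.84)); born parts = triple collars of born regions
((γ)); sizes = `treeLen` (rem-ident v1 (I-2)); the creation lineage founded in epoch `0` and consumed parts alive (the two
combinatorial sentences).  Print sums no histories and fixes no such data structure; this file makes the reading explicit
and proves what follows from it.  (iv) The model's constants `C = 10·126^d` (b02's repaired re-covering constant) and
`4·14^d` (the model's (γ)) are NOT print's `3·63^d·2^{d−1}` / `2·14^d`; they enter Lemma Y only through `log₂`.  Cell
census: a kernel skeleton's model-side binders discharged on the cell's MODEL, NOT summit progress; NOT continuum, NOT Clay.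
-/

namespace Literature.MathematicalPhysics.QuantumFieldTheory.Balaban1983to89.T4GeometricLedger

open Literature.MathematicalPhysics.QuantumFieldTheory.Balaban1983to89
open Literature.MathematicalPhysics.QuantumFieldTheory.Balaban1983to89.B13ScaleTransfer
open Literature.MathematicalPhysics.QuantumFieldTheory.Balaban1983to89.TreeLength
open Literature.MathematicalPhysics.QuantumFieldTheory.Balaban1983to89.B16SProfile
open Literature.MathematicalPhysics.QuantumFieldTheory.Balaban1983to89.B16MergeGeometry
open Literature.MathematicalPhysics.QuantumFieldTheory.Balaban1983to89.Step.Budget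
open Finset

noncomputable section

variable {d : ℕ}

/-! ## §0 Two geometric helpers -/

/-- Layers distribute over binary unions: `(X ∪ Y)^{~n} = X^{~n} ∪ Y^{~n}` (`…B16SProfile.iterate_collar_biUnion`).
[folklore] -/
theorem iterate_collar_union (n : ℕ) (X Y : Finset (Pt d)) :
    collar^[n] (X ∪ Y) = collar^[n] X ∪ collar^[n] Y := by
  have h : X ∪ Y = ({X, Y} : Finset (Finset (Pt d))).biUnion id := by simp
  rw [h, iterate_collar_biUnion]
  simp

/-- A family of NON-EMPTY domains whose union is non-empty and FACE-CONNECTED is touch-tree-connected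
(`…B16MergeGeometry.gconn_touchGraph_of_faceConnected` with `Z` = the union itself: every member meets it). [folklore] -/
theorem gconn_of_faceConnected_fam {α : Type*} {P : α → Finset (Pt d)} (hP : ∀ a, (P a).Nonempty) {S : Finset α}
    (hne : (fam P S).Nonempty) (hc : FaceConnected (fam P S)) : GConn (touchGraph P) S := by
  have hS : S.Nonempty := by
    obtain ⟨y, hy⟩ := hne
    obtain ⟨a, ha, -⟩ := mem_fam.1 hy
    exact ⟨a, ha⟩
  refine gconn_touchGraph_of_faceConnected P hc (Finset.Subset.refl _) (fun a ha => ?_) hS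
  obtain ⟨z, hz⟩ := hP a
  exact ⟨z, subset_fam P ha hz, hz⟩

/-! ## §1 Geometric realisation of a genealogy ledger -/

/-- GEOMETRIC GENEALOGY LEDGER of one sub-history in `ℤᵈ`: the ledger skeleton of `…T4Genealogy.Ledger` (`E` events,
`founded e`, `consumed e`, `product e`, `base₀`); the scale ratio `L`; per lineage its epoch-start domain `dom ℓ`, the
exponent profile `expo ℓ` and the number `steps ℓ` of `S`-steps of its epoch; the born regions `region i`, the founding
regions `fregions ℓ` of a lineage and the regions `eregions e` born into event `e+1`.  Data the ledger never reads
(names never founded or produced, indices beyond `E`) are padding; `Geometric` asks every domain and region, read or not,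
to be non-empty and face-connected (a single cube will do for padding). [folklore] -/
structure GeoLedger (d : ℕ) (κ ι : Type*) where
  /-- scale ratio of the operation `S` (`ratio L (expo ℓ)`) [folklore] -/
  L : ℕ
  /-- number of events [folklore] -/
  E : ℕ
  /-- lineages founded during epoch `e` [folklore] -/
  founded : ℕ → Finset κ
  /-- old parts consumed by event `e+1` [folklore] -/
  consumed : ℕ → Finset κ
  /-- the lineage produced by event `e+1` [folklore] -/
  product : ℕ → κ
  /-- the creation lineage [folklore] -/
  base₀ : κ
  /-- epoch-start domain of a lineage (when founded / produced) [folklore] -/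
  dom : κ → Finset (Pt d)
  /-- exponent profile of the lineage's epoch [folklore] -/
  expo : κ → ℕ → ℕ
  /-- number of `S`-steps of the lineage's epoch until the event consuming it [folklore] -/
  steps : κ → ℕ
  /-- born regions [folklore] -/
  region : ι → Finset (Pt d)
  /-- founding regions of a lineage [folklore] -/
  fregions : κ → Finset ι
  /-- regions born into event `e+1` [folklore] -/
  eregions : ℕ → Finset ι

namespace GeoLedger

variable {κ ι : Type*} (G : GeoLedger d κ ι)

/-- The domain of lineage `ℓ` when it is consumed: `S^{steps ℓ}` of its epoch-start domain. [folklore] -/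
def cur (ℓ : κ) : Finset (Pt d) := Siter (ratio G.L (G.expo ℓ)) (G.steps ℓ) (G.dom ℓ)

/-- A born region enters the history as its triple enlargement `region^{~3}`. [folklore] -/
def newPart (i : ι) : Finset (Pt d) := collar^[3] (G.region i)

/-- The parts available to an event: current domains of lineages (left) and new parts (right). [folklore] -/
def parts : κ ⊕ ι → Finset (Pt d) := Sum.elim G.cur G.newPart

/-- The old parts of event `e+1`, as members of the parts family. [folklore] -/
def O (e : ℕ) : Finset (κ ⊕ ι) := (G.consumed e).map Function.Embedding.inl

/-- The new parts of event `e+1`, as members of the parts family. [folklore] -/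
def N (e : ℕ) : Finset (κ ⊕ ι) := (G.eregions e).map Function.Embedding.inr

/-- The vertex set of event `e+1`: consumed lineages (left) and born regions (right), as members of the parts family
(`Finset.disjSum`; equal to `O e ∪ N e`, `V_eq_union`). [folklore] -/
def V (e : ℕ) : Finset (κ ⊕ ι) := (G.consumed e).disjSum (G.eregions e)

/-- Booked birth mass of a set of regions: `Σ (treeLen + 1)`. [folklore] -/
def bmass (S : Finset ι) : ℝ := ∑ i ∈ S, (treeLen (G.region i) + 1)

/-- THE NUMERICAL LEDGER of the geometric one: sizes are `treeLen` of the epoch-start domains, founding / new-part masses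
are the booked masses of the founding / born regions. [folklore] -/
def toLedger : T4Genealogy.Ledger κ where
  E := G.E
  founded := G.founded
  consumed := G.consumed
  product := G.product
  base₀ := G.base₀
  size ℓ := treeLen (G.dom ℓ)
  fmass ℓ := G.bmass (G.fregions ℓ)
  gmass e := G.bmass (G.eregions e)

/-- `toLedger.E = E`. [folklore] -/
@[simp] theorem toLedger_E : G.toLedger.E = G.E := rfl
/-- `toLedger.founded = founded`. [folklore] -/
@[simp] theorem toLedger_founded (e : ℕ) : G.toLedger.founded e = G.founded e := rfl
/-- `toLedger.consumed = consumed`. [folklore] -/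
@[simp] theorem toLedger_consumed (e : ℕ) : G.toLedger.consumed e = G.consumed e := rfl
/-- `toLedger.product = product`. [folklore] -/
@[simp] theorem toLedger_product (e : ℕ) : G.toLedger.product e = G.product e := rfl
/-- `toLedger.base₀ = base₀`. [folklore] -/
@[simp] theorem toLedger_base₀ : G.toLedger.base₀ = G.base₀ := rfl
/-- `toLedger.size ℓ = treeLen (dom ℓ)`. [folklore] -/
@[simp] theorem toLedger_size (ℓ : κ) : G.toLedger.size ℓ = treeLen (G.dom ℓ) := rfl
/-- `toLedger.fmass ℓ = bmass (fregions ℓ)`. [folklore] -/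
@[simp] theorem toLedger_fmass (ℓ : κ) : G.toLedger.fmass ℓ = G.bmass (G.fregions ℓ) := rfl
/-- `toLedger.gmass e = bmass (eregions e)`. [folklore] -/
@[simp] theorem toLedger_gmass (e : ℕ) : G.toLedger.gmass e = G.bmass (G.eregions e) := rfl

/-- THE GEOMETRIC SENTENCES of the model (see the module docstring): scale ratio `≥ 4`; domains and regions non-empty
and face-connected; drop control along every epoch; (M-F) a founded lineage's domain is the union of the triple
enlargements of its founding regions; (M-E) the product's domain is the union of the consumed lineages' current domains and
the new parts (union reading of (1.84)). [folklore] -/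
structure Geometric : Prop where
  /-- `4 ≤ L` [folklore] -/
  four_le : 4 ≤ G.L
  /-- every domain is non-empty [folklore] -/
  dom_nonempty : ∀ ℓ, (G.dom ℓ).Nonempty
  /-- every domain is face-connected [folklore] -/
  dom_conn : ∀ ℓ, FaceConnected (G.dom ℓ)
  /-- every region is non-empty [folklore] -/
  region_nonempty : ∀ i, (G.region i).Nonempty
  /-- every region is face-connected [folklore] -/
  region_conn : ∀ i, FaceConnected (G.region i)
  /-- drop control of the exponents along each lineage's epoch [folklore] -/
  drop : ∀ ℓ, DropCtl (G.expo ℓ) (G.steps ℓ)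
  /-- (M-F) founded domain = union of the new parts of its founding regions [folklore] -/
  foundation : ∀ e, ∀ ℓ ∈ G.founded e, G.dom ℓ = fam G.newPart (G.fregions ℓ)
  /-- (M-E) merged domain = union of the consumed current domains and the new parts [folklore] -/
  event : ∀ e, e < G.E → G.dom (G.product e) = fam G.parts (G.V e)

/-! ### Member properties -/

/-- A new part is non-empty. [folklore] -/
theorem newPart_nonempty (hG : G.Geometric) (i : ι) : (G.newPart i).Nonempty :=
  T4Enlargement.iterate_collar_nonempty 3 (hG.region_nonempty i)

/-- A new part has an admissible graph (`…T4Enlargement.admissible_iterate_collar`). [folklore] -/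
theorem newPart_admissible (hG : G.Geometric) (i : ι) : ∃ T, Admissible (G.newPart i) T :=
  T4Enlargement.admissible_iterate_collar 3 (hG.region_nonempty i) (hG.region_conn i)

/-- A current domain is non-empty (`…B16SProfile.Siter_nonempty`). [folklore] -/
theorem cur_nonempty (hG : G.Geometric) (ℓ : κ) : (G.cur ℓ).Nonempty :=
  Siter_nonempty _ (hG.dom_nonempty ℓ) _

/-- A current domain is face-connected (`…B16SProfile.faceConnected_Siter`, ratios positive since `L ≥ 4`). [folklore] -/
theorem cur_conn (hG : G.Geometric) (ℓ : κ) : FaceConnected (G.cur ℓ) :=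
  faceConnected_Siter (ratio_pos (lt_of_lt_of_le (by norm_num) hG.four_le) _) (hG.dom_conn ℓ) _

/-- A current domain has an admissible graph (`…TreeLength.exists_admissible`). [folklore] -/
theorem cur_admissible (hG : G.Geometric) (ℓ : κ) : ∃ T, Admissible (G.cur ℓ) T := by
  obtain ⟨T, hT, -⟩ := exists_admissible (G.cur_nonempty hG ℓ) (G.cur_conn hG ℓ)
  exact ⟨T, hT⟩

/-- Every part is non-empty. [folklore] -/
theorem parts_nonempty (hG : G.Geometric) : ∀ x, (G.parts x).Nonempty
  | Sum.inl ℓ => G.cur_nonempty hG ℓ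
  | Sum.inr i => G.newPart_nonempty hG i

/-- Every part has an admissible graph (the binder `hP` of `…T4SizeLedger.event_size_le`). [folklore] -/
theorem parts_admissible (hG : G.Geometric) : ∀ x, ∃ T, Admissible (G.parts x) T
  | Sum.inl ℓ => G.cur_admissible hG ℓ
  | Sum.inr i => G.newPart_admissible hG i

/-- Old and new parts of an event are disjoint members of the parts family (left vs right summands). [folklore] -/
theorem disjoint_O_N (e : ℕ) : Disjoint (G.O e) (G.N e) :=
  Finset.disjoint_left.2 fun x hO hN => by
    obtain ⟨ℓ, -, rfl⟩ := Finset.mem_map.1 hO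
    obtain ⟨i, -, h⟩ := Finset.mem_map.1 hN
    simp at h

/-- Booked masses are sums of non-negative terms. [folklore] -/
theorem bmass_nonneg (S : Finset ι) : 0 ≤ G.bmass S :=
  Finset.sum_nonneg fun i _ => by linarith [treeLen_nonneg (G.region i)]

/-- A booked mass dominates the number of regions booked. [folklore] -/
theorem card_le_bmass (S : Finset ι) : (S.card : ℝ) ≤ G.bmass S := by
  have h : ∑ _i ∈ S, (1 : ℝ) ≤ G.bmass S :=
    Finset.sum_le_sum fun i _ => by linarith [treeLen_nonneg (G.region i)]
  simpa using h

/-- A founded lineage has at least one founding region (its domain is non-empty and is the union over them). [folklore] -/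
theorem fregions_nonempty (hG : G.Geometric) {e : ℕ} {ℓ : κ} (hℓ : ℓ ∈ G.founded e) : (G.fregions ℓ).Nonempty := by
  obtain ⟨y, hy⟩ := hG.dom_nonempty ℓ
  rw [hG.foundation e ℓ hℓ] at hy
  obtain ⟨i, hi, -⟩ := mem_fam.1 hy
  exact ⟨i, hi⟩

/-! ## §2 The two size inputs, discharged -/

/-- (2a) for a consumed lineage: its current domain is within its drop-control horizon, so
`treeLen (cur ℓ) ≤ modelC d·(treeLen (dom ℓ) + 1)` (`…T4EpochSize.epochSize_le_modelC`). [folklore] -/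
theorem treeLen_cur_le (hG : G.Geometric) (ℓ : κ) :
    treeLen (G.cur ℓ) ≤ T4EpochSize.modelC d * (treeLen (G.dom ℓ) + 1) :=
  T4EpochSize.epochSize_le_modelC hG.four_le (hG.drop ℓ) (hG.dom_nonempty ℓ) (hG.dom_conn ℓ) le_rfl

section Foundation

variable [DecidableEq ι]

/-- **THE FOUNDATION INPUT `hfnd` ON THE GEOMETRIC LEDGER** (`a = 4·14^d`): for every founded lineage,
`size ℓ + 1 ≤ 4·14^d·fmass ℓ` — `…T4SizeLedger.foundation_size_le` (which gives `+ 2`) with the new-part binder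
`…T4Enlargement.hnew_collar_three` and the tree-connectedness of the founding family from the face-connectedness of
`dom ℓ = ⋃ newPart (fregions ℓ)`. [folklore] -/
theorem hfnd_of_geometric (hG : G.Geometric) :
    ∀ e, e ≤ G.toLedger.E → ∀ ℓ ∈ G.toLedger.founded e,
      G.toLedger.size ℓ + 1 ≤ 4 * 14 ^ d * G.toLedger.fmass ℓ := by
  intro e _ ℓ hℓ
  have hdom : G.dom ℓ = fam G.newPart (G.fregions ℓ) := hG.foundation e ℓ hℓ
  have hS : GConn (touchGraph G.newPart) (G.fregions ℓ) := by
    refine gconn_of_faceConnected_fam (G.newPart_nonempty hG) ?_ ?_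
    · rw [← hdom]; exact hG.dom_nonempty ℓ
    · rw [← hdom]; exact hG.dom_conn ℓ
  have key := T4SizeLedger.foundation_size_le (G.newPart_admissible hG) hS (E := 4 * 14 ^ d)
    (b := fun i => treeLen (G.region i)) (fun i _ => T4Enlargement.hnew_collar_three (hG.region_nonempty i)
      (hG.region_conn i))
  change treeLen (G.dom ℓ) + 1 ≤ 4 * 14 ^ d * G.bmass (G.fregions ℓ)
  rw [hdom]
  unfold bmass
  linarith

end Foundation

section Event

variable [DecidableEq κ] [DecidableEq ι]

/-- The vertex set of an event is the union of its old and new parts. [folklore] -/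
theorem V_eq_union (e : ℕ) : G.V e = G.O e ∪ G.N e := by
  ext x
  simp [V, O, N, Finset.mem_disjSum]

/-- **THE EVENT INPUT `hev` ON THE GEOMETRIC LEDGER** (`C = modelC d = 10·126^d`, `a = 4·14^d`): for every event,
`size (product e) + 2 ≤ C·Σ_{ℓ ∈ consumed e}(size ℓ + 1) + 2·#(consumed e) + 4·14^d·gmass e` —
`…T4SizeLedger.event_size_le` on the parts family with `hold` = `treeLen_cur_le` ((2a)), `hnew` =
`…T4Enlargement.hnew_collar_three` ((γ)), `hP` = `parts_admissible`, disjointness by construction and tree-connectedness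
from the face-connectedness of the merged domain (M-E); sums transported by `Finset.sum_map`. [folklore] -/
theorem hev_of_geometric (hG : G.Geometric) :
    ∀ e, e < G.toLedger.E → G.toLedger.size (G.toLedger.product e) + 2 ≤
      T4EpochSize.modelC d * ∑ ℓ ∈ G.toLedger.consumed e, (G.toLedger.size ℓ + 1) +
        2 * ((G.toLedger.consumed e).card : ℝ) + 4 * 14 ^ d * G.toLedger.gmass e := by
  intro e he
  have hev : G.dom (G.product e) = fam G.parts (G.O e ∪ G.N e) := by rw [← V_eq_union]; exact hG.event e he
  have hS : GConn (touchGraph G.parts) (G.O e ∪ G.N e) := by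
    refine gconn_of_faceConnected_fam (G.parts_nonempty hG) ?_ ?_
    · rw [← hev]; exact hG.dom_nonempty _
    · rw [← hev]; exact hG.dom_conn _
  let σ : κ ⊕ ι → ℝ := Sum.elim (fun ℓ => treeLen (G.dom ℓ)) (fun _ => 0)
  let b : κ ⊕ ι → ℝ := Sum.elim (fun _ => 0) (fun i => treeLen (G.region i))
  have hold : ∀ x ∈ G.O e, treeLen (G.parts x) ≤ T4EpochSize.modelC d * (σ x + 1) := by
    intro x hx
    obtain ⟨ℓ, -, rfl⟩ := Finset.mem_map.1 hx
    exact G.treeLen_cur_le hG ℓ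
  have hnew : ∀ x ∈ G.N e, treeLen (G.parts x) + 2 ≤ 4 * 14 ^ d * (b x + 1) := by
    intro x hx
    obtain ⟨i, -, rfl⟩ := Finset.mem_map.1 hx
    exact T4Enlargement.hnew_collar_three (hG.region_nonempty i) (hG.region_conn i)
  have key := T4SizeLedger.event_size_le (G.parts_admissible hG) (G.disjoint_O_N e) hS hold hnew
  have hsO : ∑ x ∈ G.O e, (σ x + 1) = ∑ ℓ ∈ G.consumed e, (treeLen (G.dom ℓ) + 1) := by
    rw [O, Finset.sum_map]; rfl
  have hsN : ∑ x ∈ G.N e, (b x + 1) = G.bmass (G.eregions e) := by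
    rw [N, Finset.sum_map]; rfl
  have hcard : ((G.O e).card : ℝ) = ((G.consumed e).card : ℝ) := by rw [O, Finset.card_map]
  rw [hsO, hsN, hcard] at key
  change treeLen (G.dom (G.product e)) + 2 ≤
    T4EpochSize.modelC d * ∑ ℓ ∈ G.consumed e, (treeLen (G.dom ℓ) + 1) + 2 * ((G.consumed e).card : ℝ) +
      4 * 14 ^ d * G.bmass (G.eregions e)
  rw [hev]
  exact key

end Event

/-! ## §3 Well-formedness and Lemma Y's data binders with both size inputs discharged -/

section Binders

variable [DecidableEq κ]

/-- WELL-FORMEDNESS of the numerical ledger from the two COMBINATORIAL sentences (`base₀ ∈ founded 0`, consumed parts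
alive): sizes `treeLen ≥ 0`, a founded lineage books mass `≥ #fregions ≥ 1`, new-part masses `≥ 0`. [folklore] -/
theorem wf_of_geometric (hG : G.Geometric) (h0 : G.base₀ ∈ G.founded 0)
    (hc : ∀ e, e < G.E → G.consumed e ⊆ G.toLedger.alive e) : G.toLedger.WF where
  base₀_mem := h0
  consumed_sub := hc
  size_nonneg ℓ := treeLen_nonneg (G.dom ℓ)
  one_le_fmass e ℓ hℓ := by
    have hne : (G.fregions ℓ).Nonempty := G.fregions_nonempty hG hℓ
    have h1 : (1 : ℝ) ≤ ((G.fregions ℓ).card : ℝ) := by exact_mod_cast Finset.card_pos.2 hne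
    exact le_trans h1 (G.card_le_bmass _)
  gmass_nonneg e := G.bmass_nonneg _

variable [DecidableEq ι]

/-- **LEMMA Y's EIGHT DATA BINDERS ON THE GEOMETRIC LEDGER, BOTH SIZE INPUTS DISCHARGED**: for a `Geometric` ledger with
`base₀ ∈ founded 0`, consumed parts alive, `1 ≤ d`, at most `m` events and `Dtot ≤ D`, the binders
`hf hv hΨ0 hfound hstep hD hV hσ` of `…T4BankAgeYoung.lifetime_lt` hold for `toLedger` with `C = modelC d` and new-part
constant `4·14^d` — `…T4Genealogy.Ledger.lifetime_binders_four` with `hfnd := hfnd_of_geometric`,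
`hev := hev_of_geometric`. [folklore] -/
theorem lifetime_binders_of_geometric (hG : G.Geometric) (h0 : G.base₀ ∈ G.founded 0)
    (hc : ∀ e, e < G.E → G.consumed e ⊆ G.toLedger.alive e) (hd : 1 ≤ d) {m : ℕ} (hm : G.E ≤ m) {D : ℝ}
    (hDD : G.toLedger.Dtot ≤ D) :
    (∀ i, 0 ≤ G.toLedger.f i) ∧ (∀ i, 0 ≤ G.toLedger.v i) ∧ 0 ≤ G.toLedger.Ψ 0 ∧
    G.toLedger.Ψ 0 ≤ 4 * 14 ^ d * G.toLedger.f 0 ∧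
    (∀ i, G.toLedger.Ψ (i + 1) ≤ T4EpochSize.modelC d * G.toLedger.Ψ i +
      (4 * 14 ^ d * G.toLedger.f (i + 1) + 2 * d * G.toLedger.v (i + 1))) ∧
    (∑ i ∈ Finset.range (m + 1), G.toLedger.f i ≤ D) ∧
    (∑ i ∈ Finset.range (m + 1), G.toLedger.v i ≤ 2 * m + D) ∧
    (∀ i, i ≤ m → ∃ t, t ≤ m ∧ G.toLedger.σ i ≤ T4EpochSize.modelC d * G.toLedger.Ψ t) :=
  G.toLedger.lifetime_binders_four (G.wf_of_geometric hG h0 hc) (T4EpochSize.one_le_modelC d) hd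
    (G.hfnd_of_geometric hG) (G.hev_of_geometric hG) hm hDD

end Binders

/-! ## §5 End to end: Lemma Y for a geometric ledger (doubled booking, cover profiles of the epoch bases) -/

section EndToEnd

/-- THE NUMERICAL LEDGER WITH DOUBLED BOOKING: every region is booked with mass `2·(treeLen + 1)`.  The model's new-part
constant `4·14^d = 2·(2·14^d)` (`…T4Enlargement`) is thereby absorbed into the masses, so that the two size inputs hold in
the LITERAL shapes of `…T4BankAgeYoung.lifetime_lt` / `…T4GenealogyLifetime` (constant `2·14^d`) — the ledger-side form
of the rescaling `f ↦ 2f`, `D ↦ 2D` of `…T4BankAgeYoung` v1.1 §9; the price is the reading `Dtot₂ = 2·Dtot ≤ D` of the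
S-side credit (threshold (P5) doubled to (P5₂), record §6). [folklore] -/
def toLedger₂ : T4Genealogy.Ledger κ :=
  { G.toLedger with fmass := fun ℓ => 2 * G.bmass (G.fregions ℓ), gmass := fun e => 2 * G.bmass (G.eregions e) }

/-- `toLedger₂.E = E`. [folklore] -/
@[simp] theorem toLedger₂_E : G.toLedger₂.E = G.E := rfl
/-- `toLedger₂.founded = founded`. [folklore] -/
@[simp] theorem toLedger₂_founded (e : ℕ) : G.toLedger₂.founded e = G.founded e := rfl
/-- `toLedger₂.consumed = consumed`. [folklore] -/
@[simp] theorem toLedger₂_consumed (e : ℕ) : G.toLedger₂.consumed e = G.consumed e := rfl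
/-- `toLedger₂.product = product`. [folklore] -/
@[simp] theorem toLedger₂_product (e : ℕ) : G.toLedger₂.product e = G.product e := rfl
/-- `toLedger₂.base₀ = base₀`. [folklore] -/
@[simp] theorem toLedger₂_base₀ : G.toLedger₂.base₀ = G.base₀ := rfl
/-- `toLedger₂.size ℓ = treeLen (dom ℓ)`. [folklore] -/
@[simp] theorem toLedger₂_size (ℓ : κ) : G.toLedger₂.size ℓ = treeLen (G.dom ℓ) := rfl
/-- `toLedger₂.fmass ℓ = 2·bmass (fregions ℓ)`. [folklore] -/
@[simp] theorem toLedger₂_fmass (ℓ : κ) : G.toLedger₂.fmass ℓ = 2 * G.bmass (G.fregions ℓ) := rfl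
/-- `toLedger₂.gmass e = 2·bmass (eregions e)`. [folklore] -/
@[simp] theorem toLedger₂_gmass (e : ℕ) : G.toLedger₂.gmass e = 2 * G.bmass (G.eregions e) := rfl
/-- The BASE LINEAGE of epoch `i`: the creation lineage for `i = 0`, the product of event `i` for `i ≥ 1`. [folklore] -/
def base : ℕ → κ
  | 0 => G.base₀
  | e + 1 => G.product e

/-- The epoch-start sizes `σ` of the ledger ARE the model sizes of the epoch bases' domains (the binder `hZσ` of
`…T4GenealogyLifetime.lifetime_lt_of_ledger_cover`, with equality). [folklore] -/
theorem treeLen_dom_base_le_σ : ∀ i, i ≤ G.E → treeLen (G.dom (G.base i)) ≤ G.toLedger₂.σ i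
  | 0, _ => le_of_eq rfl
  | e + 1, he => by
    rw [T4Genealogy.Ledger.σ_succ_of_lt _ (show e < G.toLedger₂.E from he)]
    exact le_of_eq rfl

section DoubledInputs

variable [DecidableEq κ]

/-- The alive sets do not depend on the booking. [folklore] -/
theorem toLedger₂_alive (e : ℕ) : G.toLedger₂.alive e = G.toLedger.alive e := by
  induction e with
  | zero => rfl
  | succ e ih => simp only [T4Genealogy.Ledger.alive, ih]; rfl

/-- Well-formedness of the doubled booking (founding masses `≥ 2 ≥ 1`). [folklore] -/
theorem wf₂_of_geometric (hG : G.Geometric) (h0 : G.base₀ ∈ G.founded 0)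
    (hc : ∀ e, e < G.E → G.consumed e ⊆ G.toLedger.alive e) : G.toLedger₂.WF where
  base₀_mem := h0
  consumed_sub e he := by rw [toLedger₂_alive]; exact hc e he
  size_nonneg ℓ := treeLen_nonneg (G.dom ℓ)
  one_le_fmass e ℓ hℓ := by
    have hne : (G.fregions ℓ).Nonempty := G.fregions_nonempty hG hℓ
    have h1 : (1 : ℝ) ≤ ((G.fregions ℓ).card : ℝ) := by exact_mod_cast Finset.card_pos.2 hne
    have h2 := G.card_le_bmass (G.fregions ℓ)
    simp only [toLedger₂_fmass]
    linarith
  gmass_nonneg e := by simp only [toLedger₂_gmass]; linarith [G.bmass_nonneg (G.eregions e)]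

end DoubledInputs

section Composition

variable [DecidableEq ι]

/-- The foundation input in the literal `2·14^d` shape, for the doubled booking. [folklore] -/
theorem hfnd₂_of_geometric (hG : G.Geometric) :
    ∀ e, e ≤ G.toLedger₂.E → ∀ ℓ ∈ G.toLedger₂.founded e,
      G.toLedger₂.size ℓ + 1 ≤ 2 * 14 ^ d * G.toLedger₂.fmass ℓ := by
  intro e he ℓ hℓ
  have h := G.hfnd_of_geometric hG e he ℓ hℓ
  simp only [toLedger_size, toLedger_fmass] at h
  simp only [toLedger₂_size, toLedger₂_fmass]
  linarith

variable [DecidableEq κ]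

/-- The event input in the literal `2·14^d` shape (`C = modelC d`), for the doubled booking. [folklore] -/
theorem hev₂_of_geometric (hG : G.Geometric) :
    ∀ e, e < G.toLedger₂.E → G.toLedger₂.size (G.toLedger₂.product e) + 2 ≤
      T4EpochSize.modelC d * ∑ ℓ ∈ G.toLedger₂.consumed e, (G.toLedger₂.size ℓ + 1) +
        2 * ((G.toLedger₂.consumed e).card : ℝ) + 2 * 14 ^ d * G.toLedger₂.gmass e := by
  intro e he
  have h := G.hev_of_geometric hG e he
  simp only [toLedger_size, toLedger_product, toLedger_consumed, toLedger_gmass] at h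
  simp only [toLedger₂_size, toLedger₂_product, toLedger₂_consumed, toLedger₂_gmass]
  linarith

/-- **LEMMA Y FOR A GEOMETRIC LEDGER, END TO END** — `…T4GenealogyLifetime.lifetime_lt_of_ledger_cover` applied to the
doubled booking with EVERY MODEL-SIDE BINDER DISCHARGED: well-formedness (`wf₂_of_geometric`), both size inputs
(`hfnd₂_of_geometric`, `hev₂_of_geometric`), the epoch bases `Z i = dom (base i)` with their exponent profiles / horizons
(non-empty, face-connected, drop-controlled: `Geometric`) and `hZσ` (`treeLen_dom_base_le_σ`), hence `hint` / `hhalf`;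
`m = E` and the epoch lengths ARE the `S`-step counts `steps (base i)` of the base lineages.  What is still a binder:
the S-side credit reading (`hDD : Dtot₂ ≤ D`, the bank `hb`, `hbA`, (P5) `hce hp hP5`), the printed horizon per epoch
(`hlen`: the step count is at most an index that is `0` or carries a cover of positive size, plus the window `R i ≤ Rmax`),
`1 ≤ d`, and the two combinatorial sentences.  Conclusion: the model lifetime `Σ_{i ≤ E} steps (base i)` is
`< A·epochAllowance d (modelC d) Rmax A`. [folklore] -/
theorem lifetime_lt_of_geometric (hG : G.Geometric) (h0 : G.base₀ ∈ G.founded 0)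
    (hc : ∀ e, e < G.E → G.consumed e ⊆ G.toLedger.alive e) (hd : 1 ≤ d)
    {D A : ℕ} (hDD : G.toLedger₂.Dtot ≤ (D : ℝ))
    {ce cs p₀ b : ℝ} (hce : 0 < ce) (hp : 0 < p₀) (hP5 : ce ≤ cs * p₀)
    (hb : ce * p₀ * G.E + cs * p₀ ^ 2 * D ≤ b) (hbA : b < ce * p₀ * A)
    {R : ℕ → ℝ} {Rmax : ℝ} (hRmax : 0 ≤ Rmax) (hR : ∀ i, i ≤ G.E → R i ≤ Rmax)
    (hlen : ∀ i, i ≤ G.E → ∃ k : ℕ,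
      (k = 0 ∨ 0 < T4EpochSize.coverProfile G.L (G.expo (G.base i)) (G.steps (G.base i)) (G.dom (G.base i)) k) ∧
        ((G.steps (G.base i) : ℕ) : ℝ) ≤ k + R i) :
    (∑ i ∈ Finset.range (G.E + 1), ((G.steps (G.base i) : ℕ) : ℝ)) <
      A * T4BankAgeYoung.epochAllowance d (T4EpochSize.modelC d) Rmax A :=
  T4GenealogyLifetime.lifetime_lt_of_ledger_cover G.toLedger₂ (G.wf₂_of_geometric hG h0 hc)
    (T4EpochSize.one_le_modelC d) hd (G.hfnd₂_of_geometric hG) (G.hev₂_of_geometric hG) (m := G.E) le_rfl hDD hce hp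
    hP5 hb hbA hG.four_le (sc := fun i => G.expo (G.base i)) (hor := fun i => G.steps (G.base i))
    (fun i _ => hG.drop (G.base i)) (Z := fun i => G.dom (G.base i)) (fun i _ => hG.dom_nonempty (G.base i))
    (fun i _ => hG.dom_conn (G.base i)) G.treeLen_dom_base_le_σ hRmax (len := fun i => G.steps (G.base i)) hlen hR

end Composition

end EndToEnd

end GeoLedger

/-! ## §4 Non-vacuity (`d = 1`) -/

section NonVacuity

open B16MergeGeometry.OneDim

/-- `{0} ∪ {1} = {0, 1}` as rows of cubes on the line. [folklore] -/
theorem row_zero_union_row_one : row 0 0 ∪ row 1 0 = row 0 1 := by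
  simpa using row_union_row 0 0 0

/-- THE TEST LEDGER: creation lineage `0` founded on the cube `0` (domain = its triple collar), one event consuming it at
once (`steps = 0`) together with the new part of the born cube `1`, producing lineage `1` with domain the triple collar of
the two-cube row; everything else is padding. [folklore] -/
def geoEx : GeoLedger 1 ℕ ℕ where
  L := 4
  E := 1
  founded e := if e = 0 then {0} else ∅
  consumed _ := {0}
  product _ := 1
  base₀ := 0
  dom ℓ := if ℓ = 0 then collar^[3] (row 0 0) else if ℓ = 1 then collar^[3] (row 0 1) else row 0 0
  expo _ _ := 0
  steps _ := 0
  region i := if i = 0 then row 0 0 else row 1 0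
  fregions _ := {0}
  eregions _ := {1}

/-- The test ledger satisfies the geometric sentences. [folklore] -/
theorem geoEx_geometric : geoEx.Geometric where
  four_le := le_rfl
  dom_nonempty ℓ := by
    simp only [geoEx]
    split_ifs
    · exact T4Enlargement.iterate_collar_nonempty 3 (row_nonempty 0 0)
    · exact T4Enlargement.iterate_collar_nonempty 3 (row_nonempty 0 1)
    · exact row_nonempty 0 0
  dom_conn ℓ := by
    simp only [geoEx]
    split_ifs
    · exact faceConnected_iterate_collar 3 (faceConnected_row 0 0)
    · exact faceConnected_iterate_collar 3 (faceConnected_row 0 1)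
    · exact faceConnected_row 0 0
  region_nonempty i := by
    simp only [geoEx]
    split_ifs
    · exact row_nonempty 0 0
    · exact row_nonempty 1 0
  region_conn i := by
    simp only [geoEx]
    split_ifs
    · exact faceConnected_row 0 0
    · exact faceConnected_row 1 0
  drop ℓ := by
    intro i k hik hk
    simp only [geoEx] at hk
    omega
  foundation e ℓ hℓ := by
    have h0 : ℓ = 0 := by
      simp only [geoEx] at hℓ
      split_ifs at hℓ <;> simp_all
    subst h0
    simp [geoEx, GeoLedger.newPart]
  event e he := by
    have h0 : e = 0 := by simp only [geoEx] at he; omega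
    subst h0
    have h : fam geoEx.parts (geoEx.V 0) = collar^[3] (row 0 0) ∪ collar^[3] (row 1 0) := by
      rw [GeoLedger.V_eq_union]
      simp [GeoLedger.O, GeoLedger.N, fam, GeoLedger.parts, GeoLedger.cur, GeoLedger.newPart, geoEx]
    rw [h, ← iterate_collar_union, row_zero_union_row_one]
    simp [geoEx]

/-- The test ledger's combinatorial sentences: the creation lineage is founded in epoch `0`, the consumed part is alive.
[folklore] -/
theorem geoEx_wf : geoEx.toLedger.WF :=
  geoEx.wf_of_geometric geoEx_geometric (by simp [geoEx]) fun e he => by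
    have h0 : e = 0 := by simp only [geoEx] at he; omega
    subst h0
    simp [geoEx, GeoLedger.toLedger]

/-- NON-VACUITY: the hypotheses of `lifetime_binders_of_geometric` are jointly inhabited by a ledger with one event, one
consumed part and one born part; in particular the event input then reads
`treeLen (dom 1) + 2 ≤ modelC 1·(treeLen (dom 0) + 1) + 2 + 4·14·(treeLen (row 1 0) + 1)`. [folklore] -/
example : geoEx.Geometric ∧ geoEx.toLedger.WF ∧ geoEx.toLedger.E = 1 ∧ (geoEx.consumed 0).Nonempty ∧
    (geoEx.eregions 0).Nonempty ∧
    geoEx.toLedger.size (geoEx.toLedger.product 0) + 2 ≤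
      T4EpochSize.modelC 1 * ∑ ℓ ∈ geoEx.toLedger.consumed 0, (geoEx.toLedger.size ℓ + 1) +
        2 * ((geoEx.toLedger.consumed 0).card : ℝ) + 4 * 14 ^ 1 * geoEx.toLedger.gmass 0 :=
  ⟨geoEx_geometric, geoEx_wf, rfl, ⟨0, by simp [geoEx]⟩, ⟨1, by simp [geoEx]⟩,
    geoEx.hev_of_geometric geoEx_geometric 0 (by simp [geoEx])⟩

end NonVacuity

end

end Literature.MathematicalPhysics.QuantumFieldTheory.Balaban1983to89.T4GeometricLedger
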